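import Mathlib
import Summits.RiemannHypothesis.RiemannHypothesis.Theorems.SoloBlindUniversalInvisible

/-!
# SoloBlind artefact 18 — the single pair on the CRITICAL lattice is visible exactly when `sinh(2δa) > 4δa`

Context (soloist `solo-RiemannHypothesis-blind`, report `paper/window-height.md` §12.4–12.5, referee-notes s15 item 3,
claim C63).  Lattice model at the critical spacing `2π/s = 2a` (window `(-a, a]` = one full period; the frame of Theorem D1 is
then an orthogonal basis).  Configuration `Z({0}, δ)`: on-line zeros at `u_j = js`, `j ≠ 0`, and ONE pair `0 ∓ iδ` at the site
`j = 0`.  Its zero-side functional on a test function `g` supported in the window is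
`Q(g) = Σ_{j ≠ 0} |H(u_j)|² + 2 Re[H(-iδ) conj H(iδ)]`, `H(z) = ∫ g(x) e^{izx} dx`.

* `soloBlind_singlePair_visible`: if `a < ∫_{-a}^{a} sinh²(δx) dx` then the explicit odd test function
  `g = sinh(δ·)·𝟙_{(-a,a]}` gives `Q(g) < 0` (indeed `Q(g) = 2L(a - L)`, `L = ∫ sinh²`): the pair is VISIBLE.
* `soloBlind_integral_sinh_sq`: `∫_{-a}^{a} sinh²(δx) dx = sinh(2δa)/(2δ) - a` (`δ ≠ 0`), so the hypothesis reads
  `sinh(2δa) > 4δa`, i.e. `δa > 1.0887` (`soloBlind_singlePair_visible_of_sinh`).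

The converse (invisibility of the single pair for `sinh(2δa) ≤ 4δa`, by parity separation in the orthogonal basis) is prose
(§12.5); together they give the exact single-pair constant `x₁(0) = 1.0887` used as control (v) of TABLE 12.4, to be compared
with the universal bounds `0.65848 ≤ x_U ≤ 0.84494` (artefact 17, Theorem V).  Mathlib + artefacts 7/13/16 only; no sorries.
-/

open MeasureTheory Complex Set
open scoped Real ComplexConjugate

namespace Summit.RiemannHypothesis.RiemannHypothesis.Theorems

/-- An odd function has zero integral over `-a..a`. -/
theorem soloBlind_intervalIntegral_odd_eq_zero {f : ℝ → ℝ} (a : ℝ) (hf : ∀ x, f (-x) = -f x) :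
    ∫ x in -a..a, f x = 0 := by
  have h := intervalIntegral.integral_comp_neg (a := -a) (b := a) f
  simp only [neg_neg] at h
  have h2 : ∫ x in -a..a, f (-x) = -∫ x in -a..a, f x := by
    rw [← intervalIntegral.integral_neg]
    congr 1; funext x; exact hf x
  linarith

/-- `∫_{-a}^{a} sinh²(δx) dx = sinh(2δa)/(2δ) - a` for `δ ≠ 0`. -/
theorem soloBlind_integral_sinh_sq (a δ : ℝ) (hδ : δ ≠ 0) :
    ∫ x in -a..a, Real.sinh (δ * x) ^ 2 = Real.sinh (2 * δ * a) / (2 * δ) - a := by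
  have hderiv : ∀ x ∈ Set.uIcc (-a) a,
      HasDerivAt (fun x => Real.sinh (2 * δ * x) / (4 * δ) - x / 2) (Real.sinh (δ * x) ^ 2) x := by
    intro x _
    have h1 : HasDerivAt (fun x => 2 * δ * x) (2 * δ) x := by
      simpa using (hasDerivAt_id x).const_mul (2 * δ)
    have h2 : HasDerivAt (fun x => Real.sinh (2 * δ * x)) (Real.cosh (2 * δ * x) * (2 * δ)) x :=
      (Real.hasDerivAt_sinh _).comp x h1
    have h3 : HasDerivAt (fun y => Real.sinh (2 * δ * y) / (4 * δ) - y / 2)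
        (Real.cosh (2 * δ * x) * (2 * δ) / (4 * δ) - 1 / 2) x := by
      exact (h2.div_const (4 * δ)).sub ((hasDerivAt_id x).div_const 2)
    refine h3.congr_deriv ?_
    have hc : Real.cosh (2 * δ * x) = 2 * Real.sinh (δ * x) ^ 2 + 1 := by
      rw [show 2 * δ * x = 2 * (δ * x) by ring, Real.cosh_two_mul, Real.cosh_sq']
      ring
    rw [hc]
    field_simp
    ring
  have hcont : ContinuousOn (fun x => Real.sinh (δ * x) ^ 2) (Set.uIcc (-a) a) :=
    ((Real.continuous_sinh.comp (continuous_const.mul continuous_id)).pow 2).continuousOn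
  rw [intervalIntegral.integral_eq_sub_of_hasDerivAt hderiv (hcont.intervalIntegrable)]
  have : Real.sinh (2 * δ * -a) = -Real.sinh (2 * δ * a) := by
    rw [show 2 * δ * -a = -(2 * δ * a) by ring, Real.sinh_neg]
  rw [this]
  field_simp
  ring

/-- **The single pair on the critical lattice is visible when `a < ∫_{-a}^{a} sinh²(δx) dx`.**
Sites `u_j = js` with `2π/s = 2a`; the pair of depth `δ` sits at `j = 0`; witness `g = sinh(δ·)` on the window. -/
theorem soloBlind_singlePair_visible (s a δ : ℝ) (hs : 0 < s) (ha : 0 < a) (hcrit : 2 * π / s = 2 * a)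
    (hvis : a < ∫ x in -a..a, Real.sinh (δ * x) ^ 2) :
    ∃ g : ℝ → ℂ, MemLp g 2 volume ∧ Function.support g ⊆ Ioc (-a) a ∧
      (∑' j : ℤ, (if j = 0 then
        2 * ((∫ x : ℝ, g x * cexp (I * ((((0:ℝ) + j * s : ℝ) : ℂ) - I * δ) * (x : ℂ))) *
            conj ((∫ x : ℝ, g x * cexp (I * ((((0:ℝ) + j * s : ℝ) : ℂ) + I * δ) * (x : ℂ))))).re
      else ‖(∫ x : ℝ, g x * cexp (I * ((((0:ℝ) + j * s : ℝ) : ℂ)) * (x : ℂ)))‖ ^ 2)) < 0 := by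
  set L : ℝ := ∫ x in -a..a, Real.sinh (δ * x) ^ 2 with hL
  set g : ℝ → ℂ := Set.indicator (Ioc (-a) a) (fun x => ((Real.sinh (δ * x) : ℝ) : ℂ)) with hgdef
  have haa : -a ≤ a := by linarith
  have hcs : Continuous fun x : ℝ => ((Real.sinh (δ * x) : ℝ) : ℂ) :=
    Complex.continuous_ofReal.comp (Real.continuous_sinh.comp (continuous_const.mul continuous_id))
  have hsupp : Function.support g ⊆ Ioc (-a) a := Set.support_indicator_subset
  have hmeas : AEStronglyMeasurable g volume :=
    hcs.aestronglyMeasurable.indicator measurableSet_Ioc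
  -- `‖g‖²` is the indicator of `sinh²`
  have hnorm : (fun x => ‖g x‖ ^ 2) = Set.indicator (Ioc (-a) a) (fun x => Real.sinh (δ * x) ^ 2) := by
    funext x
    by_cases hx : x ∈ Ioc (-a) a
    · simp only [hgdef, Set.indicator_of_mem hx, Complex.norm_real, Real.norm_eq_abs, sq_abs]
    · simp [hgdef, Set.indicator_of_notMem hx]
  have hint_sq : Integrable (fun x => ‖g x‖ ^ 2) := by
    rw [hnorm, integrable_indicator_iff measurableSet_Ioc]
    exact (((Real.continuous_sinh.comp (continuous_const.mul continuous_id)).pow 2).continuousOn.integrableOn_Icc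
      (a := -a) (b := a)).mono_set Ioc_subset_Icc_self
  have hg : MemLp g 2 volume := (memLp_two_iff_integrable_sq_norm hmeas).mpr hint_sq
  refine ⟨g, hg, hsupp, ?_⟩
  -- Theorem D1 on the critical lattice
  have hsuppT : Function.support g ⊆ Ioc (-a) (-a + 2 * π / s) := by
    rw [hcrit, show -a + 2 * a = a by ring]; exact hsupp
  have hH := soloBlind_lattice_normSq_hasSum (-a) s 0 hs hg hsuppT
  rw [hcrit] at hH
  -- abbreviations for the site-0 quantities
  set H0 : ℂ := ∫ x : ℝ, g x * cexp (I * ((((0:ℝ) + (0:ℤ) * s : ℝ) : ℂ)) * (x : ℂ)) with hH0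
  set Hm : ℂ := ∫ x : ℝ, g x * cexp (I * ((((0:ℝ) + (0:ℤ) * s : ℝ) : ℂ) - I * δ) * (x : ℂ)) with hHm
  set Hp : ℂ := ∫ x : ℝ, g x * cexp (I * ((((0:ℝ) + (0:ℤ) * s : ℝ) : ℂ) + I * δ) * (x : ℂ)) with hHp
  -- the series = D1 sum with the site-0 term replaced
  have hF : HasSum (fun j : ℤ => (if j = 0 then
        2 * ((∫ x : ℝ, g x * cexp (I * ((((0:ℝ) + j * s : ℝ) : ℂ) - I * δ) * (x : ℂ))) *
            conj ((∫ x : ℝ, g x * cexp (I * ((((0:ℝ) + j * s : ℝ) : ℂ) + I * δ) * (x : ℂ))))).re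
      else ‖(∫ x : ℝ, g x * cexp (I * ((((0:ℝ) + j * s : ℝ) : ℂ)) * (x : ℂ)))‖ ^ 2))
      (2 * a * (∫ x : ℝ, ‖g x‖ ^ 2) + (2 * (Hm * conj Hp).re - ‖H0‖ ^ 2)) := by
    have h2 := hasSum_ite_eq (0 : ℤ) (2 * (Hm * conj Hp).re - ‖H0‖ ^ 2)
    convert hH.add h2 using 1
    funext j
    split_ifs with hj
    · subst hj; simp only [hHm, hHp, hH0]; ring
    · ring
  rw [hF.tsum_eq]
  -- evaluate the integrals
  have hI1 : (∫ x : ℝ, ‖g x‖ ^ 2) = L := by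
    rw [hnorm, integral_indicator measurableSet_Ioc, ← intervalIntegral.integral_of_le haa]
  have hgint : ∀ (φ : ℝ → ℝ), (∫ x : ℝ, g x * ((φ x : ℝ) : ℂ)) =
      (((∫ x in -a..a, Real.sinh (δ * x) * φ x) : ℝ) : ℂ) := by
    intro φ
    have h1 : (fun x => g x * ((φ x : ℝ) : ℂ)) =
        Set.indicator (Ioc (-a) a) (fun x => (((Real.sinh (δ * x) * φ x : ℝ)) : ℂ)) := by
      funext x
      by_cases hx : x ∈ Ioc (-a) a
      · simp only [hgdef, Set.indicator_of_mem hx, Complex.ofReal_mul]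
      · simp [hgdef, Set.indicator_of_notMem hx]
    rw [h1, integral_indicator measurableSet_Ioc, ← intervalIntegral.integral_of_le haa,
      intervalIntegral.integral_ofReal]
  have hH0v : H0 = 0 := by
    have h1 : H0 = ∫ x : ℝ, g x * (((1 : ℝ) : ℝ) : ℂ) := by
      simp only [hH0]; congr 1; funext x; simp
    rw [h1, hgint]
    have : ∫ x in -a..a, Real.sinh (δ * x) * (1 : ℝ) = 0 := by
      apply soloBlind_intervalIntegral_odd_eq_zero
      intro x; rw [show δ * -x = -(δ * x) by ring, Real.sinh_neg]; ring
    rw [this]; simp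
  have hodd : ∫ x in -a..a, Real.sinh (δ * x) * Real.cosh (δ * x) = 0 := by
    apply soloBlind_intervalIntegral_odd_eq_zero
    intro x; rw [show δ * -x = -(δ * x) by ring, Real.sinh_neg, Real.cosh_neg]; ring
  have hLint : IntervalIntegrable (fun x => Real.sinh (δ * x) ^ 2) volume (-a) a :=
    ((Real.continuous_sinh.comp (continuous_const.mul continuous_id)).pow 2).intervalIntegrable _ _
  have hMint : IntervalIntegrable (fun x => Real.sinh (δ * x) * Real.cosh (δ * x)) volume (-a) a :=
    ((Real.continuous_sinh.comp (continuous_const.mul continuous_id)).mul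
      (Real.continuous_cosh.comp (continuous_const.mul continuous_id))).intervalIntegrable _ _
  have hHmv : Hm = (L : ℂ) := by
    have h1 : Hm = ∫ x : ℝ, g x * (((Real.exp (δ * x) : ℝ) : ℝ) : ℂ) := by
      simp only [hHm]; congr 1; funext x; congr 1
      rw [Complex.ofReal_exp]; congr 1; push_cast
      linear_combination (-(δ : ℂ) * (x : ℂ)) * Complex.I_mul_I
    rw [h1, hgint]
    congr 1
    have h2 : (fun x => Real.sinh (δ * x) * Real.exp (δ * x)) =
        fun x => Real.sinh (δ * x) ^ 2 + Real.sinh (δ * x) * Real.cosh (δ * x) := by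
      funext x; rw [← Real.cosh_add_sinh]; ring
    rw [h2, intervalIntegral.integral_add hLint hMint, hodd, add_zero]
  have hHpv : Hp = -(L : ℂ) := by
    have h1 : Hp = ∫ x : ℝ, g x * (((Real.exp (-(δ * x)) : ℝ) : ℝ) : ℂ) := by
      simp only [hHp]; congr 1; funext x; congr 1
      rw [Complex.ofReal_exp]; congr 1; push_cast
      linear_combination ((δ : ℂ) * (x : ℂ)) * Complex.I_mul_I
    rw [h1, hgint]
    rw [← Complex.ofReal_neg]; congr 1
    have h2 : (fun x => Real.sinh (δ * x) * Real.exp (-(δ * x))) =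
        fun x => Real.sinh (δ * x) * Real.cosh (δ * x) - Real.sinh (δ * x) ^ 2 := by
      funext x; rw [← Real.cosh_sub_sinh]; ring
    rw [h2, intervalIntegral.integral_sub hMint hLint, hodd, zero_sub]
  rw [hI1, hHmv, hHpv, hH0v]
  simp only [map_neg, Complex.conj_ofReal, norm_zero]
  have hre : (((L : ℂ)) * -(L : ℂ)).re = -(L * L) := by
    simp [Complex.mul_re]
  rw [hre]
  have hLa : a < L := hvis
  nlinarith [hLa, ha]

/-- **Corollary (the closed form).**  With `2π/s = 2a`, `0 < δ` and `4δa < sinh(2δa)` (i.e. `δa > 1.0887…`), the single pair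
at depth `δ` on the critical lattice is visible. -/
theorem soloBlind_singlePair_visible_of_sinh (s a δ : ℝ) (hs : 0 < s) (ha : 0 < a) (hcrit : 2 * π / s = 2 * a)
    (hδ : 0 < δ) (hvis : 4 * δ * a < Real.sinh (2 * δ * a)) :
    ∃ g : ℝ → ℂ, MemLp g 2 volume ∧ Function.support g ⊆ Ioc (-a) a ∧
      (∑' j : ℤ, (if j = 0 then
        2 * ((∫ x : ℝ, g x * cexp (I * ((((0:ℝ) + j * s : ℝ) : ℂ) - I * δ) * (x : ℂ))) *
            conj ((∫ x : ℝ, g x * cexp (I * ((((0:ℝ) + j * s : ℝ) : ℂ) + I * δ) * (x : ℂ))))).re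
      else ‖(∫ x : ℝ, g x * cexp (I * ((((0:ℝ) + j * s : ℝ) : ℂ)) * (x : ℂ)))‖ ^ 2)) < 0 := by
  apply soloBlind_singlePair_visible s a δ hs ha hcrit
  rw [soloBlind_integral_sinh_sq a δ (ne_of_gt hδ)]
  rw [lt_sub_iff_add_lt, lt_div_iff₀ (by positivity)]
  linarith

end Summit.RiemannHypothesis.RiemannHypothesis.Theorems
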